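import Mathlib.Geometry.Manifold.ContMDiff.Atlas
import Mathlib.Geometry.Manifold.MFDeriv.Atlas
import Literature.Geometry.Lorentzian.IPlusRegular
import Literature.Geometry.Lorentzian.KillingOnIntegralCurveUnique
import Literature.Geometry.Manifold.FlowBox
import HarnessLib

/-!
# Crux `HawkingExtensionIsKerr` (stmt-FinalStateConjecture-17840), line `SketchIdeator2` —
# programme SEC, brick SEC-2b: K-charts of the event horizon

Helper file of the line lead (c7), registered sub-goal `stub_sec_kchart`.

Programme SEC builds a smooth spacelike section of the event horizon `𝓔⁺ = 𝓑.horizon` of a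
stationary black hole out of **K-charts**: pairs of mutually inverse smooth maps
`χ : W → O ⊆ E4`, `χi : O → W` (`W` open, inside the open set `U ⊇ 𝓔⁺` on which `K` is a Killing
field) which STRAIGHTEN the field, `dχ_x (K x) = e₀ := EuclideanSpace.single 0 1`, and in which the
horizon is the coordinate hyperplane `{χ · 1 = 0}`.  This file proves their existence about every
horizon point (`stub_sec_kchart`) from

* the K-chart kinematics of brick SEC-1 (`stub_sec_chartLines`, first hypothesis: chart lines
  `σ ↦ χi (χ x + σ e₀)` are integral curves of `K`, and chart lines issuing from horizon points stay
  on the horizon while in the box),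
* the model-space shear of brick SEC-2a (`stub_sec_shear`, second hypothesis: a local
  diffeomorphism `Θ` of `E4` fixing `0` with `dΘ (k) = e₀` and `(Θ y) 1 = f` read on the leaf
  through `y`),
* the flow box of `K` (Lee 2012, Thm. 9.22; tree
  `Literature.Geometry.Manifold.exists_chart_mfderiv_eq_const`) and the smooth local defining
  functions `F` of `𝓔⁺` of programme HR (hypothesis `hdef`: `𝓔⁺ ∩ W₀ = {F = 0}`,
  `dF = c g(K, ·)`, `c ≠ 0`).

Construction: flow-box chart `ψ` of `K` about `p` inside the domain `W₀` of `F`; the coordinate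
expression `f z = F (ψ⁻¹ (z + ψ p))` has `f 0 = 0`, `df₀ (K p) = c g(K, K) = 0` (`K` is null on
`𝓔⁺`) and `df₀ ≠ 0` (`g` is nondegenerate, `K p ≠ 0`); the shear `Θ` of `f` gives
`χ x = Θ (ψ x - ψ p)`, `χi z = ψ⁻¹ (Θi z + ψ p)`.  The horizon clause: `(χ x) 1 = F x̂` with
`x̂ = χi (χ x - (χ x) 0 • e₀)` on the chart line through `x`, and chart lines from horizon points
stay on the horizon (SEC-1 (c), in both directions), so `x ∈ 𝓔⁺ ↔ x̂ ∈ 𝓔⁺ ↔ F x̂ = 0`.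
-/

noncomputable section

set_option linter.dupNamespace false

namespace Summit.FinalStateConjecture.FinalStateConjecture.Theorems.HawkingExtensionIsKerr.SketchIdeator2

open Set Filter Bundle Function Literature.Geometry.Lorentzian
open scoped Manifold ContDiff Topology

/-- On a line `σ ↦ z + σ • v` of `E4`, an open convex set `O` containing the points of parameters
`0` and `τ` contains the points of all parameters `σ` of an open interval `(a, b) ∋ τ` with
`a < 0 < b`. [folklore] -/
private theorem exists_Ioo_line_subset {O : Set E4} (hO : IsOpen O) (hOc : Convex ℝ O)
    {z v : E4} {τ : ℝ} (hz : z ∈ O) (hτ : z + τ • v ∈ O) :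
    ∃ a b : ℝ, a < 0 ∧ 0 < b ∧ τ ∈ Ioo a b ∧ ∀ σ ∈ Ioo a b, z + σ • v ∈ O := by
  set T : Set ℝ := {σ | z + σ • v ∈ O} with hT
  have hTo : IsOpen T :=
    hO.preimage (continuous_const.add (continuous_id.smul continuous_const))
  have hTc : Convex ℝ T := by
    intro σ₁ hσ₁ σ₂ hσ₂ a b ha hb hab
    have key : a • (z + σ₁ • v) + b • (z + σ₂ • v) = z + (a * σ₁ + b * σ₂) • v := by
      calc a • (z + σ₁ • v) + b • (z + σ₂ • v)
          = (a + b) • z + ((a * σ₁) • v + (b * σ₂) • v) := by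
            simp only [smul_add, smul_smul, add_smul]; abel
        _ = z + (a * σ₁ + b * σ₂) • v := by rw [hab, one_smul, add_smul]
    show z + (a * σ₁ + b * σ₂) • v ∈ O
    rw [← key]
    exact hOc hσ₁ hσ₂ ha hb hab
  have h0 : (0 : ℝ) ∈ T := by
    show z + (0 : ℝ) • v ∈ O
    rw [zero_smul, add_zero]
    exact hz
  obtain ⟨ε₁, hε₁, h₁⟩ := Metric.isOpen_iff.mp hTo 0 h0
  obtain ⟨ε₂, hε₂, h₂⟩ := Metric.isOpen_iff.mp hTo τ hτ
  rw [Real.ball_eq_Ioo] at h₁ h₂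
  have ha : min (0 - ε₁ / 2) (τ - ε₂ / 2) ∈ T := by
    rcases min_choice (0 - ε₁ / 2) (τ - ε₂ / 2) with h | h <;> rw [h]
    · exact h₁ ⟨by linarith, by linarith⟩
    · exact h₂ ⟨by linarith, by linarith⟩
  have hb : max (0 + ε₁ / 2) (τ + ε₂ / 2) ∈ T := by
    rcases max_choice (0 + ε₁ / 2) (τ + ε₂ / 2) with h | h <;> rw [h]
    · exact h₁ ⟨by linarith, by linarith⟩
    · exact h₂ ⟨by linarith, by linarith⟩
  refine ⟨min (0 - ε₁ / 2) (τ - ε₂ / 2), max (0 + ε₁ / 2) (τ + ε₂ / 2),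
    (min_le_left _ _).trans_lt (by linarith), lt_of_lt_of_le (by linarith) (le_max_left _ _),
    ⟨(min_le_right _ _).trans_lt (by linarith), lt_of_lt_of_le (by linarith) (le_max_right _ _)⟩,
    fun σ hσ ↦ ?_⟩
  exact (hTc.ordConnected.out ha hb) (Ioo_subset_Icc_self hσ)

/-- **SEC-2b (K-charts of the event horizon).**  Let `K` be a Killing field on an open `U ⊇ 𝓔⁺`,
nowhere zero and null on `𝓔⁺`, locally tangent to `𝓔⁺` (integral curves from horizon points stay
on the horizon for a short time) and let `𝓔⁺` carry smooth local defining functions `F`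
(`{F = 0} = 𝓔⁺`, `dF = c g(K, ·)`, `c ≠ 0`, programme HR).  Granted the K-chart kinematics
(brick SEC-1, first hypothesis) and the model-space shear (brick SEC-2a, second hypothesis), every
horizon point `p` has a K-chart: mutually inverse smooth `χ : W → O`, `χi : O → W`, `W ∋ p` open in
`U`, `χ p = 0`, straightening `K` (`dχ_x (K x) = e₀`) and flattening the horizon
(`x ∈ 𝓔⁺ ↔ (χ x) 1 = 0` on `W`).  Flow box (Lee 2012, Thm. 9.22) sheared by the HR defining
function; Chruściel–Costa 2008, §4.1 (structure of `𝓔⁺` near a point). -/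
theorem stub_sec_kchart : (∀ (𝓑 : StationaryAFBlackHole.{0}) [𝓑.metric.HasLeviCivita] (U : Set 𝓑.carrier) (K : Π x : 𝓑.carrier, TangentSpace (𝓡 4) x), IsOpen U → 𝓑.horizon ⊆ U → 𝓑.metric.toPseudoRiemannianMetric.IsKillingFieldOn K U → ∀ (W : Set 𝓑.carrier) (O : Set E4) (χ : 𝓑.carrier → E4) (χi : E4 → 𝓑.carrier), IsOpen W → IsOpen O → W ⊆ U → (∀ x ∈ W, χ x ∈ O ∧ χi (χ x) = x) → (∀ y ∈ O, χi y ∈ W ∧ χ (χi y) = y) → ContMDiffOn (𝓡 4) 𝓘(ℝ, E4) ∞ χ W → ContMDiffOn 𝓘(ℝ, E4) (𝓡 4) ∞ χi O → (∀ x ∈ W, mfderiv (𝓡 4) 𝓘(ℝ, E4) χ x (K x) = EuclideanSpace.single 0 1) → (∀ x ∈ W, ∀ a b : ℝ, (∀ σ ∈ Ioo a b, χ x + σ • EuclideanSpace.single 0 1 ∈ O) → IsMIntegralCurveOn (fun σ : ℝ ↦ χi (χ x + σ • EuclideanSpace.single 0 1)) K (Ioo a b)) ∧ (∀ (γ : ℝ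 → 𝓑.carrier) (a b t₀ : ℝ), t₀ ∈ Ioo a b → IsMIntegralCurveOn γ K (Ioo a b) → (∀ t ∈ Ioo a b, γ t ∈ W) → ∀ t ∈ Ioo a b, χ (γ t) = χ (γ t₀) + (t - t₀) • EuclideanSpace.single 0 1) ∧ ((∀ p ∈ 𝓑.horizon, ∃ ε > (0 : ℝ), ∃ γ : ℝ → 𝓑.carrier, γ 0 = p ∧ IsMIntegralCurveOn γ K (Ioo (-ε) ε) ∧ ∀ t ∈ Ioo (-ε) ε, γ t ∈ 𝓑.horizon) → (∃ F : 𝓑.carrier → ℝ, ContinuousOn F W ∧ ∀ x ∈ W, x ∈ 𝓑.horizon ↔ F x = 0) → ∀ x ∈ W, ∀ a b : ℝ, a < 0 → 0 < b → (∀ σ ∈ Ioo a b, χ x + σ • EuclideanSpace.single 0 1 ∈ O) → x ∈ 𝓑.horizon → ∀ σ ∈ Ioo a b, χi (χ x + σ • EuclideanSpace.single 0 1) ∈ 𝓑.horizon)) → (∀ (f : E4 → ℝ) (S : Set E4) (k : E4), IsOpen S → (0 : E4) ∈ S → ContDiffOn ℝ ∞ f S → f 0 = 0 → k ≠ 0 →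 fderiv ℝ f 0 k = 0 → fderiv ℝ f 0 ≠ 0 → ∃ (O₁ O₂ : Set E4) (Θ Θi : E4 → E4), IsOpen O₁ ∧ IsOpen O₂ ∧ Convex ℝ O₂ ∧ (0 : E4) ∈ O₁ ∧ O₁ ⊆ S ∧ Θ 0 = 0 ∧ (∀ y ∈ O₁, Θ y ∈ O₂ ∧ Θi (Θ y) = y) ∧ (∀ z ∈ O₂, Θi z ∈ O₁ ∧ Θ (Θi z) = z) ∧ ContDiffOn ℝ ∞ Θ O₁ ∧ ContDiffOn ℝ ∞ Θi O₂ ∧ (∀ y ∈ O₁, fderiv ℝ Θ y k = EuclideanSpace.single 0 1) ∧ (∀ z ∈ O₂, z - (z 0) • EuclideanSpace.single 0 1 ∈ O₂) ∧ (∀ y ∈ O₁, (Θ y) 1 = f (Θi (Θ y - ((Θ y) 0) • EuclideanSpace.single 0 1)))) →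
    ∀ (𝓑 : StationaryAFBlackHole.{0}) [𝓑.metric.HasLeviCivita] (U : Set 𝓑.carrier) (K : Π x : 𝓑.carrier, TangentSpace (𝓡 4) x), IsOpen U → 𝓑.horizon ⊆ U → 𝓑.metric.toPseudoRiemannianMetric.IsKillingFieldOn K U → (∀ p ∈ 𝓑.horizon, K p ≠ 0) → (∀ p ∈ 𝓑.horizon, 𝓑.metric.val p (K p) (K p) = 0) → (∀ p ∈ 𝓑.horizon, ∃ ε > (0 : ℝ), ∃ γ : ℝ → 𝓑.carrier, γ 0 = p ∧ IsMIntegralCurveOn γ K (Ioo (-ε) ε) ∧ ∀ t ∈ Ioo (-ε) ε, γ t ∈ 𝓑.horizon) → (∀ p ∈ 𝓑.horizon, ∃ W : Set 𝓑.carrier, IsOpen W ∧ p ∈ W ∧ W ⊆ U ∧ ∃ F : 𝓑.carrier → ℝ, ContMDiffOn (𝓡 4) 𝓘(ℝ, ℝ) ∞ F W ∧ (∀ x ∈ W, x ∈ 𝓑.horizon ↔ F x = 0) ∧ (∀ x ∈ W, x ∈ 𝓑.doc ↔ F x < 0) ∧ ∀ x ∈ W ∩ 𝓑.horizon, ∃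 c : ℝ, c ≠ 0 ∧ ∀ w : TangentSpace (𝓡 4) x, mfderiv (𝓡 4) 𝓘(ℝ, ℝ) F x w = c * 𝓑.metric.val x (K x) w) →
    ∀ p ∈ 𝓑.horizon, ∃ (W : Set 𝓑.carrier) (O : Set E4) (χ : 𝓑.carrier → E4) (χi : E4 → 𝓑.carrier), IsOpen W ∧ IsOpen O ∧ W ⊆ U ∧ p ∈ W ∧ χ p = 0 ∧ (∀ x ∈ W, χ x ∈ O ∧ χi (χ x) = x) ∧ (∀ y ∈ O, χi y ∈ W ∧ χ (χi y) = y) ∧ ContMDiffOn (𝓡 4) 𝓘(ℝ, E4) ∞ χ W ∧ ContMDiffOn 𝓘(ℝ, E4) (𝓡 4) ∞ χi O ∧ (∀ x ∈ W, mfderiv (𝓡 4) 𝓘(ℝ, E4) χ x (K x) = EuclideanSpace.single 0 1) ∧ (∀ x ∈ W, x ∈ 𝓑.horizon ↔ χ x 1 = 0) := by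
  intro hlines hshear 𝓑 _ U K hU hHU hKon hKne hKnull htan hdef p hp
  -- (1) the HR defining function about `p`
  obtain ⟨W₀, hW₀o, hpW₀, hW₀U, F, hF, hFhor, -, hFgrad⟩ := hdef p hp
  -- (2) the flow box of `K` about `p` inside `W₀`
  obtain ⟨ψ, hψ, hpψ, hψW₀, hψK₀, hψKs₀⟩ :=
    Literature.Geometry.Manifold.exists_chart_mfderiv_eq_const (V := K) hW₀o
      (hKon.contMDiffOn.mono hW₀U) hpW₀ (hKne p hp)
  set q₀ : E4 := ψ p with hq₀
  set k : E4 := K p with hk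
  have hψK : ∀ x ∈ ψ.source, mfderiv (𝓡 4) 𝓘(ℝ, E4) ψ x (K x) = k := hψK₀
  have hψKs : ∀ x ∈ ψ.source, mfderiv 𝓘(ℝ, E4) (𝓡 4) ψ.symm (ψ x) k = K x := hψKs₀
  have hψmd : ψ.MDifferentiable (𝓡 4) (𝓡 4) :=
    ⟨(contMDiffOn_of_mem_maximalAtlas hψ).mdifferentiableOn (by simp),
      (contMDiffOn_symm_of_mem_maximalAtlas hψ).mdifferentiableOn (by simp)⟩
  have hq₀t : q₀ ∈ ψ.target := ψ.map_source hpψ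
  have hpp : ψ.symm q₀ = p := ψ.left_inv hpψ
  -- (3) the model-space function `f z = F (ψ⁻¹ (z + ψ p))`
  set g : E4 → ℝ := F ∘ ψ.symm with hg
  set f : E4 → ℝ := fun z ↦ g (z + q₀) with hf
  set S : Set E4 := (fun z : E4 ↦ z + q₀) ⁻¹' ψ.target with hS
  have hSo : IsOpen S := ψ.open_target.preimage (continuous_add_const q₀)
  have h0S : (0 : E4) ∈ S := by
    show (0 : E4) + q₀ ∈ ψ.target
    rw [zero_add]
    exact hq₀t
  have hgm : ContMDiffOn 𝓘(ℝ, E4) 𝓘(ℝ, ℝ) ∞ g ψ.target :=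
    hF.comp (contMDiffOn_symm_of_mem_maximalAtlas hψ) fun q hq ↦ hψW₀ (ψ.map_target hq)
  have hfs : ContDiffOn ℝ ∞ f S :=
    (contMDiffOn_iff_contDiffOn.1 hgm).comp (contDiff_id.add contDiff_const).contDiffOn
      fun z hz ↦ hz
  have hf0 : f 0 = 0 := by
    show F (ψ.symm ((0 : E4) + q₀)) = 0
    rw [zero_add, hpp]
    exact (hFhor p hpW₀).1 hp
  -- the differential of `f` at `0`: `df₀ v = dF_p (dψ⁻¹ v)`
  have hFd : MDifferentiableAt (𝓡 4) 𝓘(ℝ, ℝ) F p :=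
    (hF.contMDiffAt (hW₀o.mem_nhds hpW₀)).mdifferentiableAt (by simp)
  have hψsd : MDifferentiableAt 𝓘(ℝ, E4) (𝓡 4) ψ.symm q₀ := hψmd.mdifferentiableAt_symm hq₀t
  have hgd : HasMFDerivAt 𝓘(ℝ, E4) 𝓘(ℝ, ℝ) g q₀
      ((mfderiv (𝓡 4) 𝓘(ℝ, ℝ) F p).comp (mfderiv 𝓘(ℝ, E4) (𝓡 4) ψ.symm q₀)) := by
    have h2 : HasMFDerivAt (𝓡 4) 𝓘(ℝ, ℝ) F (ψ.symm q₀) (mfderiv (𝓡 4) 𝓘(ℝ, ℝ) F p) := by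
      rw [hpp]
      exact hFd.hasMFDerivAt
    exact h2.comp q₀ hψsd.hasMFDerivAt
  have hfd : ∀ v : E4, fderiv ℝ f 0 v =
      mfderiv (𝓡 4) 𝓘(ℝ, ℝ) F p (mfderiv 𝓘(ℝ, E4) (𝓡 4) ψ.symm q₀ v) := by
    intro v
    rw [hf, fderiv_comp_add_right, zero_add, ← mfderiv_eq_fderiv, hgd.mfderiv]
    rfl
  obtain ⟨c, hc0, hc⟩ := hFgrad p ⟨hpW₀, hp⟩
  have hkne : k ≠ 0 := hKne p hp
  have hk0 : fderiv ℝ f 0 k = 0 := by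
    rw [hfd, hψKs p hpψ, hc, hKnull p hp, mul_zero]
  have hfne : fderiv ℝ f 0 ≠ 0 := by
    -- a vector `w` with `g(K p, w) ≠ 0` (nondegeneracy), read in the chart
    obtain ⟨w, hw⟩ : ∃ w : TangentSpace (𝓡 4) p, 𝓑.metric.val p (K p) w ≠ 0 := by
      by_contra h
      push Not at h
      exact hkne (𝓑.metric.nondegenerate p (K p) h)
    intro h0
    have h1 := hfd (mfderiv (𝓡 4) 𝓘(ℝ, E4) ψ p w)
    have h2 : mfderiv 𝓘(ℝ, E4) (𝓡 4) ψ.symm q₀ (mfderiv (𝓡 4) 𝓘(ℝ, E4) ψ p w) = w :=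
      congrArg (fun L : TangentSpace (𝓡 4) p →L[ℝ] TangentSpace (𝓡 4) p ↦ L w)
        (hψmd.symm_comp_deriv hpψ)
    rw [h0, h2, hc, zero_apply] at h1
    exact mul_ne_zero hc0 hw h1.symm
  -- the shear of brick SEC-2a
  obtain ⟨O₁, O₂, Θ, Θi, hO₁o, hO₂o, hO₂c, h0O₁, hO₁S, hΘ0, hΘl, hΘr, hΘs, hΘis, hΘk, hO₂e,
    hΘ1⟩ := hshear f S k hSo h0S hfs hf0 hkne hk0 hfne
  -- (4) the K-chart
  set Θ' : E4 → E4 := fun y ↦ Θ (y - q₀) with hΘ'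
  set χ : 𝓑.carrier → E4 := Θ' ∘ ψ with hχ
  set χi : E4 → 𝓑.carrier := ψ.symm ∘ fun z ↦ Θi z + q₀ with hχi
  set W : Set 𝓑.carrier := ψ.source ∩ ψ ⁻¹' ((fun y : E4 ↦ y - q₀) ⁻¹' O₁) with hW
  have hWo : IsOpen W := ψ.isOpen_inter_preimage (hO₁o.preimage (continuous_sub_right q₀))
  have hpW : p ∈ W := by
    refine ⟨hpψ, ?_⟩
    show ψ p - q₀ ∈ O₁
    rw [hq₀, sub_self]
    exact h0O₁
  have hWU : W ⊆ U := fun x hx ↦ hW₀U (hψW₀ hx.1)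
  have hχp : χ p = 0 := by
    show Θ (ψ p - q₀) = 0
    rw [hq₀, sub_self]
    exact hΘ0
  have hχW : ∀ x ∈ W, χ x ∈ O₂ ∧ χi (χ x) = x := by
    intro x hx
    refine ⟨(hΘl _ hx.2).1, ?_⟩
    show ψ.symm (Θi (Θ (ψ x - q₀)) + q₀) = x
    rw [(hΘl _ hx.2).2, sub_add_cancel, ψ.left_inv hx.1]
  have hχiO : ∀ z ∈ O₂, χi z ∈ W ∧ χ (χi z) = z := by
    intro z hz
    have h1 : Θi z + q₀ ∈ ψ.target := hO₁S (hΘr z hz).1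
    have h2 : ψ (ψ.symm (Θi z + q₀)) = Θi z + q₀ := ψ.right_inv h1
    refine ⟨⟨ψ.map_target h1, ?_⟩, ?_⟩
    · show ψ (ψ.symm (Θi z + q₀)) - q₀ ∈ O₁
      rw [h2, add_sub_cancel_right]
      exact (hΘr z hz).1
    · show Θ (ψ (ψ.symm (Θi z + q₀)) - q₀) = z
      rw [h2, add_sub_cancel_right]
      exact (hΘr z hz).2
  have hχc : ContMDiffOn (𝓡 4) 𝓘(ℝ, E4) ∞ χ W := by
    have hΘ'c : ContMDiffOn 𝓘(ℝ, E4) 𝓘(ℝ, E4) ∞ Θ' ((fun y : E4 ↦ y - q₀) ⁻¹' O₁) :=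
      contMDiffOn_iff_contDiffOn.2
        (hΘs.comp (contDiff_id.sub contDiff_const).contDiffOn fun y hy ↦ hy)
    exact hΘ'c.comp ((contMDiffOn_of_mem_maximalAtlas hψ).mono inter_subset_left)
      fun x hx ↦ hx.2
  have hχic : ContMDiffOn 𝓘(ℝ, E4) (𝓡 4) ∞ χi O₂ :=
    (contMDiffOn_symm_of_mem_maximalAtlas hψ).comp
      (contMDiffOn_iff_contDiffOn.2 (hΘis.add contDiffOn_const)) fun z hz ↦ hO₁S (hΘr z hz).1
  have hχK : ∀ x ∈ W, mfderiv (𝓡 4) 𝓘(ℝ, E4) χ x (K x) = EuclideanSpace.single 0 1 := by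
    intro x hx
    have hψx : MDifferentiableAt (𝓡 4) 𝓘(ℝ, E4) ψ x := hψmd.mdifferentiableAt hx.1
    have hΘd : DifferentiableAt ℝ Θ (ψ x - q₀) :=
      (hΘs.differentiableOn (by simp) _ hx.2).differentiableAt (hO₁o.mem_nhds hx.2)
    have hΘ'd : DifferentiableAt ℝ Θ' (ψ x) := by
      rw [hΘ', differentiableAt_comp_sub]
      exact hΘd
    have hΘ'm : MDifferentiableAt 𝓘(ℝ, E4) 𝓘(ℝ, E4) Θ' (ψ x) :=
      mdifferentiableAt_iff_differentiableAt.mpr hΘ'd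
    rw [hχ, mfderiv_comp x hΘ'm hψx]
    show mfderiv 𝓘(ℝ, E4) 𝓘(ℝ, E4) Θ' (ψ x) (mfderiv (𝓡 4) 𝓘(ℝ, E4) ψ x (K x)) = _
    rw [hψK x hx.1, mfderiv_eq_fderiv, hΘ', fderiv_comp_sub]
    exact hΘk _ hx.2
  -- (5) the horizon clause, by the chart-line kinematics of brick SEC-1
  have hC := (hlines 𝓑 U K hU hHU hKon W O₂ χ χi hWo hO₂o hWU hχW hχiO hχc hχic hχK).2.2 htan
    ⟨F, hF.continuousOn.mono fun x hx ↦ hψW₀ hx.1, fun x hx ↦ hFhor x (hψW₀ hx.1)⟩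
  have hline : ∀ x ∈ W, x ∈ 𝓑.horizon → ∀ τ : ℝ,
      χ x + τ • EuclideanSpace.single 0 1 ∈ O₂ →
        χi (χ x + τ • EuclideanSpace.single 0 1) ∈ 𝓑.horizon := by
    intro x hx hxh τ hτ
    obtain ⟨a, b, ha, hb, hτab, hsub⟩ := exists_Ioo_line_subset hO₂o hO₂c (hχW x hx).1 hτ
    exact hC x hx a b ha hb hsub hxh τ hτab
  have hhor : ∀ x ∈ W, x ∈ 𝓑.horizon ↔ χ x 1 = 0 := by
    intro x hx
    have hz : χ x ∈ O₂ := (hχW x hx).1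
    have hzhO : χ x - (χ x 0) • EuclideanSpace.single 0 1 ∈ O₂ := hO₂e _ hz
    have hx' : χi (χ x - (χ x 0) • EuclideanSpace.single 0 1) ∈ W := (hχiO _ hzhO).1
    have hx'W₀ : χi (χ x - (χ x 0) • EuclideanSpace.single 0 1) ∈ W₀ := hψW₀ hx'.1
    -- `(χ x) 1 = F x̂`, the last clause of the shear
    have h1 : χ x 1 = F (χi (χ x - (χ x 0) • EuclideanSpace.single 0 1)) := hΘ1 _ hx.2
    have hfwd : x ∈ 𝓑.horizon →
        χi (χ x - (χ x 0) • EuclideanSpace.single 0 1) ∈ 𝓑.horizon := fun hxh ↦ by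
      have h := hline x hx hxh (-(χ x 0)) (by rw [neg_smul, ← sub_eq_add_neg]; exact hzhO)
      rw [neg_smul, ← sub_eq_add_neg] at h
      exact h
    have hbwd : χi (χ x - (χ x 0) • EuclideanSpace.single 0 1) ∈ 𝓑.horizon →
        x ∈ 𝓑.horizon := fun h ↦ by
      have h2 : χ (χi (χ x - (χ x 0) • EuclideanSpace.single 0 1)) +
          (χ x 0) • EuclideanSpace.single 0 1 = χ x := by
        rw [(hχiO _ hzhO).2, sub_add_cancel]
      have h3 := hline _ hx' h (χ x 0) (by rw [h2]; exact hz)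
      rw [h2, (hχW x hx).2] at h3
      exact h3
    rw [h1]
    exact ⟨fun h ↦ (hFhor _ hx'W₀).1 (hfwd h), fun h ↦ hbwd ((hFhor _ hx'W₀).2 h)⟩
  exact ⟨W, O₂, χ, χi, hWo, hO₂o, hWU, hpW, hχp, hχW, hχiO, hχc, hχic, hχK, hhor⟩

end Summit.FinalStateConjecture.FinalStateConjecture.Theorems.HawkingExtensionIsKerr.SketchIdeator2

end
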